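import Mathlib.RepresentationTheory.Homological.GroupCohomology.LongExactSequence
import Mathlib.RepresentationTheory.Homological.GroupCohomology.Shapiro
import HarnessLib

/-!
# Hochschild–Serre without the spectral sequence: operators killing `H•(Γ, W)` act nilpotently
# on `H^q(Γ, W^H)`

Topic `Algebra/Homology`; namespace `Literature.Algebra.Homology`.  Auxiliary definitions with
bodies and theorems; no named fact; Mathlib only.

Let `k` be a commutative ring, `Γ` and `H` groups and `W` a `k`-linear representation of
`Γ × H` (two commuting actions), `φ` an endomorphism of `W`.  Writing `W|_Γ`, `W|_H` for the
restrictions and `W^H ⊆ W|_Γ` for the `Γ`-representation on the `H`-invariants, this file builds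
everything needed for the theorem (assembled in the sibling file
`GroupCohomologyInvariantsNilpotentHolds`, `pow_succ_map_hKerRep_zero_eq_zero`, on top of
`GroupCohomologyNilpotentCoresolution`):

  **if `H^c(H, W|_H) = 0` for all `c ≥ 1` and `H^b(Γ, φ|_Γ) = 0` on `H^b(Γ, W|_Γ)` for all
  `b ≤ q`, then `H^q(Γ, φ)` acts on `H^q(Γ, W^H)` with `(q+1)`-st power zero.**

This is the consequence of the Hochschild–Serre spectral sequence
`E₂^{a,b} = Hᵃ(H, Hᵇ(Γ, W)) ⇒ H^{a+b}(Γ × H, W) = H^{a+b}(Γ, W^H)` (the last equality by the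
`H`-acyclicity of `W`) used in [Scholze2015, §V.4, proof of Thm. V.4.1] ("One has the
Hochschild–Serre spectral sequence … This reduces us to the case that `K` is sufficiently small,
and that `ξ` is trivial") to compare Hecke algebras of different levels and coefficient systems:
an operator that is `0` on every `E₂`-term with `b ≤ q` is `0` on each graded piece of the
abutment in degree `q`, whose filtration has length `q + 1`.  Mathlib has no spectral sequences;
one argues by dimension shifting instead (`Literature.Algebra.Homology.
pow_succ_map_eq_zero_of_coresolution_zero`) along the CORESOLUTION of `W^H` by the inhomogeneous
`H`-cochains of `W`, constructed here:

  `0 → W^H → C⁰(H, W) → C¹(H, W) → C²(H, W) → ⋯`,   `Cᵃ(H, W) = Fun(Hᵃ, W)`,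

a complex of `Γ`-representations (pointwise `Γ`-action; the `H`-differential is `Γ`-equivariant
because the two actions commute) which is exact in positive degrees exactly when `W|_H` is
acyclic, cut into the short exact pieces `0 → ker dᵃ → Cᵃ → ker dᵃ⁺¹ → 0`; and along the way
(`map_piConstHom_eq_zero`) that an endomorphism killing `Hᵇ(Γ, A)` kills `Hᵇ(Γ, Fun(S, A))` for
any set `S` (cocycles and coboundaries of `Fun(S, A)` are computed pointwise in `S`).

We also supply the acyclicity input in the form it arises for towers of levels
(`isZero_groupCohomology_twistedPi_succ`): for a FREE `H`-set `S` and any representation `N` of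
`H`, the twisted function representation `Fun(S, N)`, `(h f)(s) = ρ_N(h) f(h⁻¹ s)` (`twistedPi`),
has `Hⁿ⁺¹(H, Fun(S, N)) = 0` — by the orbit decomposition `Fun(S, N) ≅ Fun(S/H, Fun(H, N))`
(`twistedPiOrbitIso`), the identification `Fun(H, N) ≅ Coind_1^H N` (`twistedPiRegularIso`) and
Shapiro's lemma (Mathlib `groupCohomology.coindIso`, `isZero_groupCohomology_succ_of_subsingleton`).

Here `W^H` is realised as `hKerRep W 0 = ker(d⁰ : C⁰(H, W) → C¹(H, W))`, i.e. the functions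
`f : (Fin 0 → H) → W` with `ρ(1, h) (f ∗) = f ∗` for all `h` (`mem_hKer_zero_iff`), which is
`W^H` up to the evaluation at the unique point `∗` of `Fin 0 → H`.

Intended application (not here): `Γ = GL_n(K)`, `H = U/U_r` a finite quotient of levels acting
on `W = Fun(GL_n(𝔸_K^∞)/U_r, M/p^s)` through the free right translation (so that `W|_H` is
coinduced from the trivial group, hence acyclic by Shapiro's lemma, Mathlib
`groupCohomology.coindIso` and `isZero_groupCohomology_succ_of_subsingleton`), `W^H` the
coefficient system of level `U`, `φ` a polynomial in Hecke operators at places where `U` and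
`U_r` agree [Scholze2015, §V.4] [Emerton2006, §2.2].

## References

* P. Scholze, *On torsion in the cohomology of locally symmetric varieties*, Ann. of Math. 182
  (2015), §V.4, proof of Thm. V.4.1 [Scholze2015].
* M. Emerton, *On the interpolation of systems of eigenvalues attached to automorphic Hecke
  eigenforms*, Invent. Math. 164 (2006), §2.2 [Emerton2006].
* K. S. Brown, *Cohomology of Groups*, GTM 87 (1982), III §7, VII §6 [Brown1982CohomologyGroups].
-/

noncomputable section

open CategoryTheory groupCohomology

universe u

namespace Literature.Algebra.Homology

variable {k : Type u} [CommRing k]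

/-! ### Pointwise representations on function spaces `Fun(S, A)` -/

section PiConst

variable {Γ : Type u} [Group Γ] {V : Type u} [AddCommGroup V] [Module k V]

/-- The POINTWISE representation of `Γ` on the functions `S → V`: `(γ f)(s) = ρ(γ) (f s)` — the
product of copies of `ρ` indexed by `S`. [folklore] -/
def piConstRep (S : Type u) (ρ : Representation k Γ V) : Representation k Γ (S → V) where
  toFun γ := (ρ γ).compLeft S
  map_one' := by
    refine LinearMap.ext fun f => funext fun s => ?_
    simp
  map_mul' γ γ' := by
    refine LinearMap.ext fun f => funext fun s => ?_
    simp

omit [Group Γ] in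
/-- Unfolding lemma: `(γ f)(s) = ρ(γ) (f s)`. [folklore] -/
@[simp]
theorem piConstRep_apply [Group Γ] (S : Type u) (ρ : Representation k Γ V) (γ : Γ) (f : S → V)
    (s : S) : piConstRep S ρ γ f s = ρ γ (f s) :=
  rfl

variable (S : Type u) (A : Rep.{u} k Γ)

/-- `Fun(S, A)` with the pointwise action, as an object of `Rep k Γ`. [folklore] -/
abbrev piConst : Rep k Γ :=
  Rep.of (piConstRep S A.ρ)

variable {S} in
/-- Evaluation at `s ∈ S`, a morphism `Fun(S, A) → A` of representations. [folklore] -/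
def piConstEval (s : S) : piConst S A ⟶ A :=
  Rep.ofHom (LinearMap.intertwiningMap_of_isIntertwiningMap _ _ (LinearMap.proj s)
    fun _ _ => rfl)

/-- Unfolding lemma for `piConstEval`. [folklore] -/
@[simp]
theorem piConstEval_hom_apply (s : S) (f : S → A) : (piConstEval A s).hom f = f s :=
  rfl

variable {A} in
/-- An endomorphism `ψ` of `A` acting pointwise on `Fun(S, A)`. [folklore] -/
def piConstHom (ψ : A ⟶ A) : piConst S A ⟶ piConst S A :=
  Rep.ofHom (LinearMap.intertwiningMap_of_isIntertwiningMap _ _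
    (ψ.hom.toLinearMap.compLeft S) fun γ f => funext fun s => Rep.hom_comm_apply ψ γ (f s))

/-- Unfolding lemma for `piConstHom`: `(ψ f)(s) = ψ (f s)`. [folklore] -/
@[simp]
theorem piConstHom_hom_apply (ψ : A ⟶ A) (f : S → A) (s : S) :
    (piConstHom S ψ).hom f s = ψ.hom (f s) :=
  rfl

omit [Group Γ] in
/-- The underlying cochain of `cocyclesMap id φ c` is `φ ∘ c`. [folklore] -/
theorem iCocycles_cocyclesMap_apply [Group Γ] {B C : Rep.{u} k Γ} (φ : B ⟶ C) (n : ℕ)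
    (c : cocycles B n) :
    (iCocycles C n).hom ((cocyclesMap (MonoidHom.id Γ) φ n).hom c) =
      φ.hom.toLinearMap.compLeft _ ((iCocycles B n).hom c) := by
  rw [← LinearMap.comp_apply, ← ModuleCat.hom_comp]
  erw [HomologicalComplex.cyclesMap_i]
  rw [ModuleCat.hom_comp, LinearMap.comp_apply, cochainsMap_id_f_hom_eq_compLeft]

/-- The inhomogeneous `Γ`-cochain differential of `Fun(S, A)` is computed pointwise in `S`.
[folklore] -/
theorem inhomogeneousCochains_d_piConst_apply (i j : ℕ)
    (y : (inhomogeneousCochains (piConst S A)).X i) (g : Fin j → Γ) (s : S) :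
    ((inhomogeneousCochains (piConst S A)).d i j).hom y g s =
      ((inhomogeneousCochains A).d i j).hom (fun g' => y g' s) g := by
  by_cases hij : i + 1 = j
  · subst hij
    rw [inhomogeneousCochains.d_def, inhomogeneousCochains.d_def,
      inhomogeneousCochains.d_hom_apply, inhomogeneousCochains.d_hom_apply]
    simp only [Pi.add_apply, Finset.sum_apply, Pi.smul_apply]
    rfl
  · rw [(inhomogeneousCochains (piConst S A)).shape i j hij,
      (inhomogeneousCochains A).shape i j hij]
    rfl

/-- **An endomorphism killing `Hᵇ(Γ, A)` kills `Hᵇ(Γ, Fun(S, A))`.**  If `ψ : A → A` induces the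
zero map on `Hᵇ(Γ, A)`, then its pointwise extension to `Fun(S, A)` induces the zero map on
`Hᵇ(Γ, Fun(S, A))`, for every set `S`: a cocycle `z` of `Fun(S, A)` is a family of cocycles
`z_s` of `A`; choosing `y_s` with `d y_s = ψ ∘ z_s` gives `d (s ↦ y_s) = ψ ∘ z`.  (For finite `S`
this is additivity of `Hᵇ(Γ, −)`; the pointwise argument needs no finiteness.) [folklore] -/
theorem map_piConstHom_eq_zero (ψ : A ⟶ A) (b : ℕ)
    (hψ : groupCohomology.map (MonoidHom.id Γ) ψ b = 0) :
    groupCohomology.map (A := piConst S A) (MonoidHom.id Γ) (piConstHom S ψ) b = 0 := by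
  classical
  -- notation
  set K := inhomogeneousCochains (piConst S A) with hK
  set K' := inhomogeneousCochains A with hK'
  set i := (ComplexShape.up ℕ).prev b with hi
  -- exactness of `C^i → Z^b → H^b → 0` for `A`
  have hexA : (ShortComplex.mk (K'.toCycles i b) (K'.homologyπ b)
      (K'.toCycles_comp_homologyπ i b)).Exact :=
    ShortComplex.exact_of_g_is_cokernel _ (K'.homologyIsCokernel i b rfl)
  -- it suffices to treat classes of cocycles
  refine ModuleCat.hom_ext (LinearMap.ext fun x => ?_)
  rw [ModuleCat.hom_zero, LinearMap.zero_apply]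
  induction x using groupCohomology_induction_on with
  | h z =>
  change (groupCohomology.map (MonoidHom.id Γ) (piConstHom S ψ) b).hom
    ((groupCohomology.π (piConst S A) b).hom z) = 0
  rw [← LinearMap.comp_apply, ← ModuleCat.hom_comp, π_map, ModuleCat.hom_comp,
    LinearMap.comp_apply]
  change (K.homologyπ b).hom ((cocyclesMap (MonoidHom.id Γ) (piConstHom S ψ) b).hom z) = 0
  -- the components `z_s` and the cochains `y_s` with `d y_s = ψ ∘ z_s`
  have hy : ∀ s : S, ∃ y : K'.X i, (K'.toCycles i b).hom y =
      (cocyclesMap (MonoidHom.id Γ) ψ b).hom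
        ((cocyclesMap (MonoidHom.id Γ) (piConstEval A s) b).hom z) := by
    intro s
    refine (ShortComplex.moduleCat_exact_iff _).1 hexA _ ?_
    change (cocyclesMap (MonoidHom.id Γ) ψ b ≫ groupCohomology.π A b).hom
      ((cocyclesMap (MonoidHom.id Γ) (piConstEval A s) b).hom z) = 0
    rw [← π_map, ModuleCat.hom_comp, LinearMap.comp_apply, hψ, ModuleCat.hom_zero,
      LinearMap.zero_apply]
  choose y hy using hy
  -- `d (s ↦ y_s) = ψ ∘ z`
  obtain ⟨Y, hY⟩ : ∃ Y : K.X i, (K.toCycles i b).hom Y =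
      (cocyclesMap (MonoidHom.id Γ) (piConstHom S ψ) b).hom z := by
    refine ⟨fun g s => y s g, ?_⟩
    apply (ModuleCat.mono_iff_injective (K.iCycles b)).1 inferInstance
    rw [← LinearMap.comp_apply, ← ModuleCat.hom_comp, HomologicalComplex.toCycles_i,
      ← LinearMap.comp_apply, ← ModuleCat.hom_comp, HomologicalComplex.cyclesMap_i,
      ModuleCat.hom_comp, LinearMap.comp_apply, cochainsMap_id_f_hom_eq_compLeft]
    funext g s
    rw [inhomogeneousCochains_d_piConst_apply]
    have hs : (K'.d i b).hom (y s) = (iCocycles A b).hom ((cocyclesMap (MonoidHom.id Γ) ψ b).hom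
        ((cocyclesMap (MonoidHom.id Γ) (piConstEval A s) b).hom z)) := by
      rw [← hy s, ← LinearMap.comp_apply, ← ModuleCat.hom_comp, HomologicalComplex.toCycles_i]
    change (K'.d i b).hom (y s) g = _
    rw [hs, iCocycles_cocyclesMap_apply, iCocycles_cocyclesMap_apply]
    rfl
  rw [← hY, ← LinearMap.comp_apply, ← ModuleCat.hom_comp,
    HomologicalComplex.toCycles_comp_homologyπ, ModuleCat.hom_zero, LinearMap.zero_apply]

end PiConst

/-! ### Acyclicity gives primitives of cocycles -/

section Acyclic

variable {G : Type u} [Group G]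

/-- If `Hⁿ⁺¹(G, B) = 0`, every `(n+1)`-cocycle of `B` is a coboundary: `d x = y`. [folklore] -/
theorem exists_d_apply_eq_of_isZero (B : Rep.{u} k G) (n : ℕ)
    (hB : Limits.IsZero (groupCohomology B (n + 1))) (y : (Fin (n + 1) → G) → B)
    (hy : (inhomogeneousCochains.d B (n + 1)).hom y = 0) :
    ∃ x : (Fin n → G) → B, (inhomogeneousCochains.d B n).hom x = y := by
  set K := inhomogeneousCochains B with hK
  have hex : (ShortComplex.mk (K.toCycles n (n + 1)) (K.homologyπ (n + 1))
      (K.toCycles_comp_homologyπ n (n + 1))).Exact :=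
    ShortComplex.exact_of_g_is_cokernel _ (K.homologyIsCokernel n (n + 1) (by simp))
  have h0 : ∀ m : groupCohomology B (n + 1), m = 0 := fun m => by
    have h := congrArg (fun f => (ModuleCat.Hom.hom f) m) (hB.eq_of_src (𝟙 _) 0)
    simpa only [ModuleCat.hom_id, LinearMap.id_apply, ModuleCat.hom_zero,
      LinearMap.zero_apply] using h
  obtain ⟨x, hx⟩ := (ShortComplex.moduleCat_exact_iff _).1 hex (cocyclesMk y hy) (h0 _)
  refine ⟨x, ?_⟩
  have h := congrArg (fun c => (iCocycles B (n + 1)).hom c) hx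
  simp only at h
  rw [← LinearMap.comp_apply, ← ModuleCat.hom_comp] at h
  erw [HomologicalComplex.toCycles_i] at h
  rw [iCocycles_mk, inhomogeneousCochains.d_def] at h
  exact h

/-- The `0`-th inhomogeneous differential: `(d⁰ f)(g) = ρ(g 0) (f ∗) - f ∗`. [folklore] -/
theorem d_zero_hom_apply (B : Rep.{u} k G) (f : (Fin 0 → G) → B) (g : Fin (0 + 1) → G) :
    (inhomogeneousCochains.d B 0).hom f g = B.ρ (g 0) (f default) - f default := by
  rw [inhomogeneousCochains.d_hom_apply, Fin.sum_univ_succ, Fin.sum_univ_zero, add_zero]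
  have h1 : (fun i : Fin 0 => g i.succ) = default := Subsingleton.elim _ _
  have h2 : ∀ j : Fin (0 + 1), Fin.contractNth j (· * ·) g = default := fun j =>
    Subsingleton.elim _ _
  rw [h1, h2, sub_eq_add_neg]
  simp

end Acyclic

/-! ### Twisted function modules on free `H`-sets are acyclic -/

section FreeAction

variable {H : Type u} [Group H] (S : Type u) [MulAction H S] (N : Rep.{u} k H)

/-- The **twisted function representation** of `H` on `Fun(S, N)` for an `H`-set `S` and a
representation `N` of `H`: `(h f)(s) = ρ_N(h) (f (h⁻¹ • s))`.  (For a level `L' ◁ L` of a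
locally symmetric tower, `S = 𝒢/L'` with `h • gL' = g h⁻¹ L'`, this is the action of `L/L'` on
the coefficient functions through right translation and the coefficient representation.)
[folklore] -/
def twistedPiRep : Representation k H (S → N) where
  toFun h := (N.ρ h).compLeft S ∘ₗ LinearMap.funLeft k N fun s : S => h⁻¹ • s
  map_one' := by
    refine LinearMap.ext fun f => funext fun s => ?_
    simp
  map_mul' h h' := by
    refine LinearMap.ext fun f => funext fun s => ?_
    simp [mul_smul]

/-- Unfolding lemma: `(h f)(s) = ρ_N(h) (f (h⁻¹ • s))`. [folklore] -/
@[simp]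
theorem twistedPiRep_apply (h : H) (f : S → N) (s : S) :
    twistedPiRep S N h f s = N.ρ h (f (h⁻¹ • s)) :=
  rfl

/-- `Fun(S, N)` with the twisted action, as an object of `Rep k H`. [folklore] -/
abbrev twistedPi : Rep k H :=
  Rep.of (twistedPiRep S N)

variable {S}

/-- Every point lies in the orbit of the chosen representative of its orbit. [folklore] -/
theorem exists_smul_out_mk_eq (s : S) :
    ∃ x : H, x • (Quotient.mk (MulAction.orbitRel H S) s).out = s := by
  obtain ⟨x, hx⟩ := MulAction.orbitRel_apply.1 (Quotient.mk_out (s := MulAction.orbitRel H S) s)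
  exact ⟨x⁻¹, by rw [← hx, inv_smul_smul]⟩

/-- For a FREE action, `(t, h) ↦ h • t.out` is a bijection from (orbits) × `H` onto `S`.
[folklore] -/
theorem bijective_smul_out (hfree : ∀ (h : H) (s : S), h • s = s → h = 1) :
    Function.Bijective fun p : MulAction.orbitRel.Quotient H S × H => p.2 • p.1.out := by
  constructor
  · rintro ⟨t, h⟩ ⟨t', h'⟩ hp
    simp only at hp
    have ht : t = t' := by
      rw [← Quotient.out_eq t, ← Quotient.out_eq t']
      refine Quotient.sound (MulAction.orbitRel_apply.2 ?_)
      refine MulAction.mem_orbit_iff.2 ⟨h⁻¹ * h', ?_⟩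
      rw [mul_smul, ← hp, inv_smul_smul]
    subst ht
    have hh : h'⁻¹ * h = 1 := hfree _ _ (by rw [mul_smul, hp, inv_smul_smul])
    rw [Prod.mk.injEq, inv_mul_eq_one] at *
    exact ⟨rfl, hh.symm⟩
  · intro s
    obtain ⟨x, hx⟩ := exists_smul_out_mk_eq (H := H) s
    exact ⟨(Quotient.mk _ s, x), hx⟩

/-- The orbit decomposition `(orbits) × H ≃ S` of a free `H`-set. [folklore] -/
def orbitProdEquiv (hfree : ∀ (h : H) (s : S), h • s = s → h = 1) :
    MulAction.orbitRel.Quotient H S × H ≃ S :=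
  Equiv.ofBijective _ (bijective_smul_out hfree)

/-- Unfolding lemma for `orbitProdEquiv`. [folklore] -/
@[simp]
theorem orbitProdEquiv_apply (hfree : ∀ (h : H) (s : S), h • s = s → h = 1)
    (p : MulAction.orbitRel.Quotient H S × H) : orbitProdEquiv hfree p = p.2 • p.1.out :=
  rfl

variable (S) in
/-- **Orbit decomposition of the twisted function representation of a free `H`-set**:
`Fun(S, N) ≅ Fun(S/H, Fun(H, N))`, `H` acting on `Fun(H, N)` by the twisted action for the left
regular `H`-set `H`. [folklore] -/
def twistedPiOrbitIso (hfree : ∀ (h : H) (s : S), h • s = s → h = 1) :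
    twistedPi S N ≅ piConst (MulAction.orbitRel.Quotient H S) (twistedPi H N) :=
  Rep.mkIso (Representation.Equiv.mk
    ((LinearEquiv.funCongrLeft k N (orbitProdEquiv hfree)).trans
      (LinearEquiv.curry k N (MulAction.orbitRel.Quotient H S) H))
    fun h => LinearMap.ext fun f => funext fun t => funext fun x => by
      simp [mul_smul])

/-- **The twisted function representation of the regular `H`-set is coinduced from the trivial
subgroup**: `Fun(H, N) ≅ Coind_1^H(N)`, `ψ ↦ (x ↦ ρ_N(x) ψ(x⁻¹))` (Mathlib's `Rep.coind` along
`⊥ ↪ H`, `H` acting by right translation). [folklore] -/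
def twistedPiRegularIso :
    twistedPi H N ≅ Rep.coind (⊥ : Subgroup H).subtype (Rep.trivial k (⊥ : Subgroup H) N) :=
  Rep.mkIso (Representation.Equiv.mk
    { toFun := fun ψ => ⟨fun x => N.ρ x (ψ x⁻¹), fun g y => by
        have hg : ((⊥ : Subgroup H).subtype g : H) = 1 := (Subgroup.mem_bot).1 g.2
        rw [hg, one_mul]
        rfl⟩
      invFun := fun F y => N.ρ y (F.1 y⁻¹)
      map_add' := fun ψ ψ' => Subtype.ext (funext fun x => by simp)
      map_smul' := fun r ψ => Subtype.ext (funext fun x => by simp)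
      left_inv := fun ψ => funext fun y => by
        simp only [inv_inv]
        rw [← Module.End.mul_apply, ← map_mul, mul_inv_cancel, map_one, Module.End.one_apply]
      right_inv := fun F => Subtype.ext (funext fun x => by
        simp only [inv_inv]
        rw [← Module.End.mul_apply, ← map_mul, mul_inv_cancel, map_one,
          Module.End.one_apply]) }
    fun h => LinearMap.ext fun ψ => Subtype.ext (funext fun x => by
      change N.ρ x (N.ρ h (ψ (h⁻¹ • x⁻¹))) = N.ρ (x * h) (ψ (x * h)⁻¹)
      rw [smul_eq_mul, mul_inv_rev, map_mul, Module.End.mul_apply]))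

/-- `Fun(S, A)` is acyclic in the degrees where `A` is. [folklore] -/
theorem isZero_groupCohomology_piConst {Γ : Type u} [Group Γ] (S : Type u) (A : Rep.{u} k Γ)
    (n : ℕ) (hA : Limits.IsZero (groupCohomology A n)) :
    Limits.IsZero (groupCohomology (piConst S A) n) := by
  rw [Limits.IsZero.iff_id_eq_zero] at hA ⊢
  have h := map_piConstHom_eq_zero S A (𝟙 A) n (by rw [groupCohomology.map_id]; exact hA)
  have h1 : piConstHom S (𝟙 A) = 𝟙 (piConst S A) :=
    Rep.hom_ext (Representation.IntertwiningMap.ext (LinearMap.ext fun _ => rfl))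
  rwa [h1, groupCohomology.map_id] at h

variable (S) in
/-- **Twisted function representations of free `H`-sets are acyclic**: if `H` acts freely on
`S`, then `Hⁿ⁺¹(H, Fun(S, N)) = 0` for every representation `N` of `H` and every `n`
(orbit decomposition + `Fun(H, N) ≅ Coind_1^H N` + Shapiro's lemma, Mathlib
`groupCohomology.coindIso`, + vanishing of the cohomology of the trivial group).  This is the
acyclicity of the coefficient functions `Fun(𝒢/L', M)` for the finite group `L/L'` of a Galois
cover of levels `X_{L'} → X_L` that makes `H•(X_{L'}) ` compute `H•(X_L)` through the
Hochschild–Serre spectral sequence [cite: Scholze2015, §V.4, proof of Thm. V.4.1]. -/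
theorem isZero_groupCohomology_twistedPi_succ (hfree : ∀ (h : H) (s : S), h • s = s → h = 1)
    (n : ℕ) : Limits.IsZero (groupCohomology (twistedPi S N) (n + 1)) := by
  have hB : Limits.IsZero (groupCohomology
      (Rep.coind (⊥ : Subgroup H).subtype (Rep.trivial k (⊥ : Subgroup H) N)) (n + 1)) :=
    (isZero_groupCohomology_succ_of_subsingleton _ n).of_iso (groupCohomology.coindIso _ (n + 1))
  have hH : Limits.IsZero (groupCohomology (twistedPi H N) (n + 1)) :=
    hB.of_iso ((groupCohomology.functor k H (n + 1)).mapIso (twistedPiRegularIso N))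
  exact (isZero_groupCohomology_piConst _ _ _ hH).of_iso
    ((groupCohomology.functor k H (n + 1)).mapIso (twistedPiOrbitIso S N hfree))

end FreeAction

/-! ### The `H`-cochain coresolution of `W^H` in `Rep k Γ` -/

section Coresolution

variable {Γ H : Type u} [Group Γ] [Group H] (W : Rep.{u} k (Γ × H))

/-- `W|_Γ`, the restriction of `W` to `Γ = Γ × 1`. [folklore] -/
abbrev resFst : Rep k Γ :=
  Rep.res (MonoidHom.inl Γ H) W

/-- `W|_H`, the restriction of `W` to `H = 1 × H`. [folklore] -/
abbrev resSnd : Rep k H :=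
  Rep.res (MonoidHom.inr Γ H) W

/-- The two actions commute. [folklore] -/
theorem resSnd_resFst_comm (γ : Γ) (h : H) (v : W) :
    (resSnd W).ρ h ((resFst W).ρ γ v) = (resFst W).ρ γ ((resSnd W).ρ h v) := by
  change W.ρ (MonoidHom.inr Γ H h) (W.ρ (MonoidHom.inl Γ H γ) v) =
    W.ρ (MonoidHom.inl Γ H γ) (W.ρ (MonoidHom.inr Γ H h) v)
  rw [← Module.End.mul_apply, ← map_mul, ← (MonoidHom.commute_inl_inr γ h).eq, map_mul,
    Module.End.mul_apply]

/-- **`Cᵃ(H, W) = Fun(Hᵃ, W)` as a representation of `Γ`** (pointwise action). [folklore] -/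
abbrev hCochainsRep (a : ℕ) : Rep k Γ :=
  piConst (Fin a → H) (resFst W)

/-- The `H`-differential `dᵃ : Cᵃ(H, W) → Cᵃ⁺¹(H, W)` is `Γ`-equivariant (the actions commute).
[folklore] -/
theorem d_resSnd_comm (a : ℕ) (γ : Γ) (f : (Fin a → H) → W) :
    (inhomogeneousCochains.d (resSnd W) a).hom (piConstRep (Fin a → H) (resFst W).ρ γ f) =
      piConstRep (Fin (a + 1) → H) (resFst W).ρ γ
        ((inhomogeneousCochains.d (resSnd W) a).hom f) := by
  funext h
  rw [piConstRep_apply, inhomogeneousCochains.d_hom_apply, inhomogeneousCochains.d_hom_apply,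
    map_add, map_sum]
  congr 1
  · exact resSnd_resFst_comm W γ (h 0) _
  · refine Finset.sum_congr rfl fun j _ => ?_
    rw [map_smul]
    rfl

/-- **The differential `dᵃ : Cᵃ(H, W) → Cᵃ⁺¹(H, W)` as a morphism of `Γ`-representations.**
[folklore] -/
def hd (a : ℕ) : hCochainsRep W a ⟶ hCochainsRep W (a + 1) :=
  Rep.ofHom (LinearMap.intertwiningMap_of_isIntertwiningMap _ _
    (inhomogeneousCochains.d (resSnd W) a).hom fun γ f => d_resSnd_comm W a γ f)

/-- Unfolding lemma for `hd`. [folklore] -/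
@[simp]
theorem hd_hom_apply (a : ℕ) (f : (Fin a → H) → W) :
    (hd W a).hom f = (inhomogeneousCochains.d (resSnd W) a).hom f :=
  rfl

/-- `dᵃ⁺¹ ∘ dᵃ = 0` on inhomogeneous cochains, elementwise. [folklore] -/
theorem d_d_apply (a : ℕ) (f : (Fin a → H) → W) :
    (inhomogeneousCochains.d (resSnd W) (a + 1)).hom
      ((inhomogeneousCochains.d (resSnd W) a).hom f) = 0 := by
  have h := congrArg (fun φ => (ModuleCat.Hom.hom φ) f)
    (inhomogeneousCochains.d_comp_d (A := resSnd W) (n := a))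
  simpa only [ModuleCat.hom_comp, LinearMap.comp_apply, ModuleCat.hom_zero,
    LinearMap.zero_apply] using h

/-- **`ker dᵃ ⊆ Cᵃ(H, W)` as a representation of `Γ`**; for `a = 0` this is `W^H`
(`mem_hKer_zero_iff`). [folklore] -/
abbrev hKerRep (a : ℕ) : Rep k Γ :=
  Rep.of (hd W a).hom.ker.toRepresentation

/-- Membership in `ker dᵃ`. [folklore] -/
theorem mem_hKer_iff (a : ℕ) (f : (Fin a → H) → W) :
    f ∈ (hd W a).hom.ker.toSubmodule ↔ (inhomogeneousCochains.d (resSnd W) a).hom f = 0 := by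
  rw [Representation.IntertwiningMap.ker_toSubmodule, LinearMap.mem_ker]
  rfl

/-- **`ker d⁰ = W^H`**: a `0`-cochain `f : (Fin 0 → H) → W` lies in `ker d⁰` iff its value is
`H`-invariant, `ρ(1, h) (f ∗) = f ∗` for all `h ∈ H`. [folklore] -/
theorem mem_hKer_zero_iff (f : (Fin 0 → H) → W) :
    f ∈ (hd W 0).hom.ker.toSubmodule ↔
      ∀ h : H, W.ρ (MonoidHom.inr Γ H h) (f default) = f default := by
  rw [mem_hKer_iff]
  constructor
  · intro hf h
    have h1 := congrFun hf fun _ : Fin (0 + 1) => h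
    rw [d_zero_hom_apply, Pi.zero_apply, sub_eq_zero] at h1
    exact h1
  · intro hf
    funext g
    rw [d_zero_hom_apply, Pi.zero_apply, sub_eq_zero]
    exact hf (g 0)

/-- The inclusion `ker dᵃ ↪ Cᵃ(H, W)`. [folklore] -/
def hι (a : ℕ) : hKerRep W a ⟶ hCochainsRep W a :=
  Rep.ofHom ⟨(hd W a).hom.ker.toSubmodule.subtype, fun _ => LinearMap.ext fun _ => rfl⟩

/-- Unfolding lemma for `hι`. [folklore] -/
@[simp]
theorem hι_hom_apply (a : ℕ) (f : hKerRep W a) : (hι W a).hom f = Subtype.val f :=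
  rfl

/-- The corestriction `Cᵃ(H, W) → ker dᵃ⁺¹` of `dᵃ`. [folklore] -/
def hπ (a : ℕ) : hCochainsRep W a ⟶ hKerRep W (a + 1) :=
  Rep.ofHom ⟨LinearMap.codRestrict (hd W (a + 1)).hom.ker.toSubmodule (hd W a).hom.toLinearMap
      fun f => (mem_hKer_iff W (a + 1) _).2 (d_d_apply W a f),
    fun γ => LinearMap.ext fun f => Subtype.ext (Rep.hom_comm_apply (hd W a) γ f)⟩

/-- Unfolding lemma for `hπ`. [folklore] -/
@[simp]
theorem val_hπ_hom_apply (a : ℕ) (f : (Fin a → H) → W) :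
    Subtype.val ((hπ W a).hom f) = (inhomogeneousCochains.d (resSnd W) a).hom f :=
  rfl

/-- `ker dᵃ ↪ Cᵃ → ker dᵃ⁺¹` composes to zero. [folklore] -/
theorem hι_hπ (a : ℕ) : hι W a ≫ hπ W a = 0 := by
  refine Rep.hom_ext (Representation.IntertwiningMap.ext (LinearMap.ext fun f => ?_))
  refine Subtype.ext ?_
  change (inhomogeneousCochains.d (resSnd W) a).hom (Subtype.val f) = 0
  exact (mem_hKer_iff W a _).1 f.2

/-- **The short exact pieces `0 → ker dᵃ → Cᵃ(H, W) → ker dᵃ⁺¹ → 0` of the coresolution**, exact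
on the right as soon as `Hᵃ⁺¹(H, W|_H) = 0`. [folklore] -/
theorem hKer_shortExact (a : ℕ) (hacyc : Limits.IsZero (groupCohomology (resSnd W) (a + 1))) :
    (ShortComplex.mk (hι W a) (hπ W a) (hι_hπ W a)).ShortExact where
  exact := (forget₂ (Rep k Γ) (ModuleCat k)).reflects_exact_of_faithful _ <|
    (ShortComplex.moduleCat_exact_iff _).2 fun x hx => by
      have hx₁ : (hπ W a).hom x = 0 := hx
      have hx₂ := congrArg Subtype.val hx₁
      rw [val_hπ_hom_apply, ZeroMemClass.coe_zero] at hx₂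
      exact ⟨⟨x, (mem_hKer_iff W a _).2 hx₂⟩, rfl⟩
  mono_f := (Rep.mono_iff_injective _).2 Subtype.val_injective
  epi_g := (Rep.epi_iff_surjective _).2 fun y => by
    obtain ⟨x, hx⟩ := exists_d_apply_eq_of_isZero (resSnd W) a hacyc y.1
      ((mem_hKer_iff W (a + 1) _).1 y.2)
    exact ⟨x, Subtype.ext hx⟩

/-! ### A compatible endomorphism -/

variable (φ : W ⟶ W)

/-- `φ|_Γ`. [folklore] -/
abbrev resFstMap : resFst W ⟶ resFst W :=
  (Rep.resFunctor (MonoidHom.inl Γ H)).map φ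

/-- `φ` acting pointwise on `Cᵃ(H, W)`. [folklore] -/
abbrev φC (a : ℕ) : hCochainsRep W a ⟶ hCochainsRep W a :=
  piConstHom (Fin a → H) (resFstMap W φ)

/-- `dᵃ (φ ∘ f) = φ ∘ dᵃ f` (`φ` is `H`-equivariant and linear). [folklore] -/
theorem hd_φC_apply (a : ℕ) (f : (Fin a → H) → W) :
    (hd W a).hom ((φC W φ a).hom f) = (φC W φ (a + 1)).hom ((hd W a).hom f) := by
  funext h
  rw [hd_hom_apply, hd_hom_apply, piConstHom_hom_apply, inhomogeneousCochains.d_hom_apply,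
    inhomogeneousCochains.d_hom_apply, map_add, map_sum]
  congr 1
  · exact (Rep.hom_comm_apply φ (MonoidHom.inr Γ H (h 0)) _).symm
  · refine Finset.sum_congr rfl fun j _ => ?_
    rw [map_smul]
    rfl

/-- `φ` restricted to `ker dᵃ`. [folklore] -/
def φZ (a : ℕ) : hKerRep W a ⟶ hKerRep W a :=
  Rep.ofHom ⟨(φC W φ a).hom.toLinearMap.restrict fun f hf =>
      (mem_hKer_iff W a _).2 (by
        change (hd W a).hom ((φC W φ a).hom f) = 0
        rw [hd_φC_apply, hd_hom_apply, (mem_hKer_iff W a _).1 hf, map_zero]),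
    fun γ => LinearMap.ext fun f => Subtype.ext (Rep.hom_comm_apply (φC W φ a) γ f)⟩

/-- Compatibility `φZ ≫ ι = ι ≫ φC`. [folklore] -/
theorem φZ_hι (a : ℕ) : φZ W φ a ≫ hι W a = hι W a ≫ φC W φ a :=
  Rep.hom_ext (Representation.IntertwiningMap.ext (LinearMap.ext fun _ => rfl))

/-- Compatibility `φC ≫ π = π ≫ φZ`. [folklore] -/
theorem φC_hπ (a : ℕ) : φC W φ a ≫ hπ W a = hπ W a ≫ φZ W φ (a + 1) :=
  Rep.hom_ext (Representation.IntertwiningMap.ext (LinearMap.ext fun f =>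
    Subtype.ext (hd_φC_apply W φ a f)))

end Coresolution


end Literature.Algebra.Homology
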